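import Summits.QuantumFields.BalabanUV.Beta.FP.TowerKernelLawSym
import Summits.QuantumFields.BalabanUV.Beta.FP.TowerUTopClosedSym
import Summits.QuantumFields.BalabanUV.Beta.FP.TorusCompositeRowsDirectionalSym
import Summits.QuantumFields.BalabanUV.Beta.FP.TorusCompositeCovarianceOneRowsSym
import Summits.QuantumFields.BalabanUV.Beta.FP.TorusCompositeSliceOneShotG
import Summits.QuantumFields.BalabanUV.Beta.FP.PackedLegCombSym

/-!
# `BalabanUV.Beta.FP.TowerKernelLawNamed` — road «FP» for binder row D1, ROUTE T under RULING R-D1-g52-1 (β1) ∕ R-FP-71 … R-FP-75: **R-FP-72's NAMING ∕ DISCHARGE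
# PASS OVER #42a-Sym `TowerKernelLawSym.hessKer_law_tower_sym`** at the record's dimension `d + 1 = 4` — the (0.4)-symmetrised tower's one-loop kernel law on the
# lattice with EVERY LOCATED SUPPLIER OF THE TREE PLUGGED IN BY NAME (SPEC-45 v1.6 + the g33 addendum), and what no tree declaration supplies DISPLAYED (R-FP-71).

WHAT IS DISCHARGED (per box `B`, by the named tree declarations; 45 of #42a-Sym's binders).  (a) the DIRECTION MODULE is FIXED: directions are the TOP one-shot
SOURCE weights `v : κ B → ℝ`, the finest direction is the NESTED COMPOSITE COLUMN `hv B v = I · (minOp S₁₁ [Q₂₀; τ₂] · (v, 0), 0)` (pinned, `hhv`); (b) the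
`Q`-SIDE JETS are NAMED (pins `hQ₁₁f hQ₁₂f hQ₂₁f hQ₂₂f`: leaf-02's `c • compIns₁Sym`, `c² • compIns₂₂Sym`, the top step's sym member ∕ bi-member along the
transported direction `compRowsSym · hv B v`) and the (COV-m) images `Db₁f Db₂f` PINNED (`hDb₁f hDb₂f`), so that #21's rows `c1 d1` (leaf-02 R-22
`torus_c1_towerSym ∕ torus_d1_towerSym`), `c2 d2` (R-27∕R-38 `torus_c2_towerSym_polar ∕ torus_d2_towerSym`), the six (bi)linearity clauses (R-38 `Q11f_lin …
Q22f_lin_right`, from §0's linearity of the nested column) and `uTop` (§1: leaf-06 G-5 §2 `torus_uTop_tower_closedG` at the sym instance with `a0 hH₀t hInv hEff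
h2F` discharged by `torus_a0_tower`, `torus_H₀_transpose_comb`, leaf-05 L5G `torus_composite_inv_and_eff_sym`, `torus_isUnit_det_kkt_combRows_comb`) DISAPPEAR;
(c) R-FP-71's rows `hSL c0 hTW d0` (leaf-06 G-1 §3 `det_nestedSliceSym_mul_towerGen_ne_zero`, leaf-02 R-20 `compRowsSym_mul_towerGen_succ ∕
QtopSym_mul_smul_tgrad_res`, leaf-06 G-2 §2 `torus_hTW_oneShot_towerSym`) and `hrs` (`ctrOff_mem_box`); (d) the (S3-1) G LEG ENTIRE (leaf-05 `PackedLegCombSym`: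
`X_G := (kkt 𝓗|ff [Q₂₀; τ₂])⁻¹`, `A_G := GcombSh Lc (lev 0)` — the chart of record (III′) —, `ρ_G := ctr 4 Lc`, `L_G := Lc`, `f_G a := (pμ′ a, inr (mμ′ a))`,
its decay ∕ blocking covariance ∕ torus rules ∕ packed leg).  WHAT STAYS DISPLAYED (R-FP-71 «display what you use»): the sym pins, `lv Xbf` (linear read-outs),
the H-side `H₁f H₂f hH₁l hH₂l hH₂r hH₁t hH₂t a1 a2` (R-FP-74∕75: the TOTAL graded slots — the row's (C1) Hessian-table word, J-RISK-3′), the composite ∕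
one-shot namings, `W₁f W₂f Y₁f Y₂f Gw₁f Gw₂f`, the (S3-1) N ∕ F legs, all (S3-2) bi-localisations, parities and block bindings (an2's (C1) naming item; the G
column now at the slots `(pμ′ a, inr (mμ′ a))` and the chart `GcombSh Lc (lev 0)`).  CONCLUSION: `hessKer AN 𝒱N 𝒲N μ ν z = hessKer AF 𝒱F 𝒲F μ ν z + hessKer
(GcombSh Lc (lev 0)) 𝒱G 𝒲G μ ν z`.  Proof: ONE term of #42a-Sym (generator `g34/r72/gen72.py` over the TREE bytes of #42a-Sym; every discharged binder `:=` its
supplier's term).  [folklore] composition BY NAME; no `def`, no `def … : Prop`, nothing cited, 0 sorry.  Rows, legs, lattice letters and namings that remain are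
HYPOTHESES; nothing of the dictionary ∕ Bałaban's asserted (the presentation is the row's (β1) ruling, quoted).  No existing file touched.

HONEST DEPENDENCY (page 1, mandatory): continuum YM on T⁴ ⇐ BetaPertH ∧ nine spine estimates (0/9 proved); BetaPertH ⇐ (D1) ∧ (D4) ∧ CAP+tail;
G-an2-4 gates asym, D1 and NE2/3/4.  HONEST FRAMING (cell contract, verbatim): «discharging `BetaPertH` makes Bałaban's UV stability UNCONDITIONAL —
a real constructive-QFT result; it is NOT the continuum limit and NOT the Clay problem.»  ABSOLUTE RULE (cell charter, verbatim): «No internally-minted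
statement may enter as a cited fact. Every hypothesis is either kernel-proved in this package or a verbatim quotation of a PUBLISHED theorem with page
reference. The manuscript(s) under audit are NOT citable for their own disputed steps — they are the thing under adjudication; programme-internal
(2001/route/tribunal) claims are never citable.»  0 estimates; 0∕4 row-D1 binders (hW, hR, D1Tel, D1Rep — `D1Tel` CONCLUDED only from displayed rows);
NOT (C1), NOT (L2′), NOT (T-ID) complete, NOT SDF, NOT D1, NOT BetaPertH, NOT continuum, NOT Clay.  Road «FP» OWNER, b2b-balaban-beta-d1-p3 gen 34 (v1, R-FP-72),
2026-08-25.  No existing file touched.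
-/

noncomputable section

open scoped BigOperators Matrix

namespace Summit.QuantumFields.BalabanUV.Beta.FP.TowerKernelLawNamed

open Matrix Finset Filter
open Literature.Probability.LatticeModels (Torus.proj)
open Literature.MathematicalPhysics.QuantumFieldTheory.Balaban1983to89
open Literature.MathematicalPhysics.QuantumFieldTheory.Balaban1983to89.Beta
open Literature.MathematicalPhysics.QuantumFieldTheory.Balaban1983to89.Beta.Composition (kkt)
open Literature.MathematicalPhysics.QuantumFieldTheory.Balaban1983to89.Beta.CompositionSingular (effForm flucCov minOp minOpL)
open B4TorusKernel.MultiPeriod (translate)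
open B5Prop11Plancherel (fine)
open B6Lemma24Torus (pbox mem_pbox)
open AffineAveraging (Site box toSite unitVec)
open AveragingContoursRooted (ctr ctrOff ctrOff_mem_box)
open OneStepResolventKernel (Fib)
open ExpKernelCalculus (MKer Decays BiLoc shiftK hessKer)
open BalabanStepJetsSucc (wVH)
open Summit.QuantumFields.BalabanUV.Beta.AxialDressingRooted (axEc)
open Summit.QuantumFields.BalabanUV.Beta.BorderedHessian (stepScale)
open Summit.QuantumFields.BalabanUV.Beta.D1BFx.LogDetSecondVariation (secondVar)
open Summit.QuantumFields.BalabanUV.Beta.FP.KernelPeriodisationFib (Idx perF)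
open Summit.QuantumFields.BalabanUV.Beta.SymAveragingHessianCounts (symVhSAt)
open Summit.QuantumFields.BalabanUV.Beta.SymAveragingMixedJetTables (symVh₂SAt)
open Summit.QuantumFields.BalabanUV.Beta.SymShiftedSpread (bhKStepSh)
open Summit.QuantumFields.BalabanUV.Beta.DshAn1 (Dsh)
open Summit.QuantumFields.BalabanUV.Beta.CombChartStepJets (GcombSh)
open Summit.QuantumFields.BalabanUV.Beta.FP.KernelPeriodisationFibLoc (dper)
open Summit.QuantumFields.BalabanUV.Beta.FP.TorusCombRows (Res)
open Summit.QuantumFields.BalabanUV.Beta.FP.TorusGaugeCovariance (tgrad tdelta)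
open Summit.QuantumFields.BalabanUV.Beta.FP.TorusCompositeObjects (towerTorus NParam combF bigP towerGen)
open Summit.QuantumFields.BalabanUV.Beta.FP.TorusCompositeObjectsG (QSym compRowsSym nestedSliceSym)
open Summit.QuantumFields.BalabanUV.Beta.FP.TorusCompositeFP (evalN)
open Summit.QuantumFields.BalabanUV.Beta.GAN24.FineReadoutCauchyFrame (toSite_mem_range)
open Summit.QuantumFields.BalabanUV.Beta.FP.TorusCompositeSliceG (det_nestedSliceSym_mul_towerGen_ne_zero)
open Summit.QuantumFields.BalabanUV.Beta.FP.TorusCompositeSliceOneShotG (torus_hTW_oneShot_towerSym)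
open Summit.QuantumFields.BalabanUV.Beta.FP.TorusCompositeCovarianceSym (compRowsSym_mul_towerGen_succ QtopSym_mul_smul_tgrad_res)
open Summit.QuantumFields.BalabanUV.Beta.FP.TorusCompositeCovarianceOneSym (compIns₁Sym)
open Summit.QuantumFields.BalabanUV.Beta.FP.TorusCompositeCovarianceTwoPolarSym (compIns₂₂Sym)
open Summit.QuantumFields.BalabanUV.Beta.FP.TorusCompositeCovarianceOneRowsSym (torus_c1_towerSym torus_d1_towerSym)
open Summit.QuantumFields.BalabanUV.Beta.FP.TorusCompositeCovarianceTwoRowsSym (torus_d2_towerSym)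
open Summit.QuantumFields.BalabanUV.Beta.FP.TorusCompositeRowsDirectionalSym (Q11f_lin Q21f_lin Q12f_lin_left Q12f_lin_right Q22f_lin_left Q22f_lin_right
  torus_c2_towerSym_polar)
open Summit.QuantumFields.BalabanUV.Beta.FP.NestedStepLawTorusInstance (dvd_fine)
open Summit.QuantumFields.BalabanUV.Beta.FP.PackedLegCombSym (kkt_mul_inv_combSym packedLeg_combSym_eq perF_rules_combSym lattice_letters_combSym)
open Summit.QuantumFields.BalabanUV.Beta.FP.TowerKernelLawSym (hessKer_law_tower_sym)
open Summit.QuantumFields.BalabanUV.Beta.FP.TowerUTopClosedSym (nestedColumn_linear torus_uTop_towerSym_closed)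

section Named

variable (Lc : ℕ) [NeZero Lc] (M' : ℕ → (Fin (3 + 1) → ℕ)) [∀ B μ, NeZero (M' B μ)] (lev : ℕ → ℕ) (n : ℕ)

set_option synthInstance.maxSize 1024 in
/-- [folklore] **R-FP-72 `TowerKernelLawNamed` — THE (0.4)-SYMMETRISED TOWER's ONE-LOOP KERNEL LAW ON THE LATTICE WITH THE LOCATED SUPPLIERS PLUGGED IN**
(`d + 1 = 4`; one instance per tower depth `n`).  #42a-Sym `hessKer_law_tower_sym` with: `hrs`, R-FP-71's `hSL c0 hTW d0`, the direction module (`V B := κ B → ℝ`,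
`hv` = the nested composite column — pinned), the `Q`-side jets' six (bi)linearity clauses, #21's rows `uTop c1 c2 d1 d2` and the whole (S3-1) G leg over
`A_G := GcombSh Lc (lev 0)` DISCHARGED BY NAME; everything else displayed VERBATIM (H-side rows, namings, N ∕ F legs, (S3-2) letters and bindings). -/
theorem hessKer_law_tower_named
    (hM'gr : ∀ N : ℕ, ∀ᶠ B in atTop, ∀ i, N ≤ M' B i) (hlev : ∀ i, lev i = lev (i + 1) + 1)
    -- (P2‴)'s lattice base-point jets of the three systems (fibre `Fib d`), and the base points
    (𝒱N 𝒱F 𝒱G : Fin (3 + 1) → (Fin (3 + 1) → ℤ) → MKer (3 + 1) (Fib 3))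
    (𝒲N 𝒲F 𝒲G : Fin (3 + 1) → (Fin (3 + 1) → ℤ) → Fin (3 + 1) → (Fin (3 + 1) → ℤ) → MKer (3 + 1) (Fib 3)) (μ ν : Fin (3 + 1)) (z : Fin (3 + 1) → ℤ)
    -- #41d-G's binders AT EVERY BOX `B` (generated from its bytes; `X ↦ X B` for every box-dependent binder `X`, `M′ ↦ M′ B`; `Q K hone hId c` box-free; `hSL c0 hTW` box-indexed, R-FP-71)
    (hM' : ∀ B : ℕ, ∀ i, Lc ∣ (M' B) i)
    -- the coarse multipliers' slot presentation one level above `M′` (as (B): injective, `inr`-valued, exactly the `Lc`-coarse sites of `M′`)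
    {κ : ℕ → Type*} [∀ B : ℕ, Fintype (κ B)] [∀ B : ℕ, DecidableEq (κ B)] (pμ' : ∀ B : ℕ, (κ B) → ↥(pbox (M' B))) (mμ' : ∀ B : ℕ, (κ B) → Fin (3 + 1))
    (hfμ' : ∀ B : ℕ, Function.Injective (fun a : (κ B) => (((pμ' B) a, Sum.inr ((mμ' B) a)) : Idx (M' B) (Fib 3))))
    (hcoarse' : ∀ B : ℕ, ∀ (s : ↥(pbox (M' B))) (m : Fin (3 + 1)),
      ((s, Sum.inr m) : Idx (M' B) (Fib 3)) ∈ Set.range (fun a : (κ B) => (((pμ' B) a, Sum.inr ((mμ' B) a)) : Idx (M' B) (Fib 3))) ↔ Torus.proj Lc (s : Site (3 + 1)) = 0)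
    -- the (0.4)-SYMMETRISED composite objects PINNED (leaf-06 `TorusCompositeObjectsG` §3), roots `ctrOff (d+1) Lc` at every storey
    {H₀ : ∀ B : ℕ, Matrix (↥(pbox (towerTorus Lc (M' B) (n + 1))) × Fin (3 + 1)) (↥(pbox (towerTorus Lc (M' B) (n + 1))) × Fin (3 + 1)) ℝ}
    {Q₁₀ : ∀ B : ℕ, Matrix (↥(pbox (M' B)) × Fin (3 + 1)) (↥(pbox (towerTorus Lc (M' B) (n + 1))) × Fin (3 + 1)) ℝ}
    {τ₁ : ∀ B : ℕ, Matrix (NParam Lc (fine Lc (M' B)) (fun k => (fun _ : ℕ => ctrOff (3 + 1) Lc) (k + 1)) n) (↥(pbox (towerTorus Lc (M' B) (n + 1))) × Fin (3 + 1)) ℝ}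
    (hH₀ : ∀ B : ℕ, (H₀ B) = (perF (towerTorus Lc (M' B) (n + 1)) (bhKStepSh 3 Lc (Dsh Lc) (lev (n + 1)))).submatrix
        (fun b : (↥(pbox (towerTorus Lc (M' B) (n + 1))) × Fin (3 + 1)) => ((b.1, Sum.inl b.2) : Idx (towerTorus Lc (M' B) (n + 1)) (Fib 3)))
        (fun b : (↥(pbox (towerTorus Lc (M' B) (n + 1))) × Fin (3 + 1)) => ((b.1, Sum.inl b.2) : Idx (towerTorus Lc (M' B) (n + 1)) (Fib 3))))
    (hQ₁₀ : ∀ B : ℕ, (Q₁₀ B) = compRowsSym Lc (M' B) lev (fun _ : ℕ => ctrOff (3 + 1) Lc) (n + 1))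
    (hτ₁ : ∀ B : ℕ, (τ₁ B) = bigP Lc (fine Lc (M' B)) (fun k => (fun _ : ℕ => ctrOff (3 + 1) Lc) (k + 1)) (fun _ => toSite_mem_range (ctrOff_mem_box (d := 3 + 1) (Nat.one_le_iff_ne_zero.mpr (NeZero.ne Lc)))) n)
    {τ₂ : ∀ B : ℕ, Matrix (Res (toSite (ctrOff (3 + 1) Lc)) Lc (M' B)) (↥(pbox (M' B)) × Fin (3 + 1)) ℝ}
    (hτ₂ : ∀ B : ℕ, (τ₂ B) = combF Lc (M' B) ((fun _ : ℕ => ctrOff (3 + 1) Lc) 0))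
    -- the top step's (0.4)-symmetrised averaging rows (level `lev 0`), PINNED in (B)'s slot presentation; its comb-KKT `htop` discharged inside
    {Q₂₀ : ∀ B : ℕ, Matrix (κ B) (↥(pbox (M' B)) × Fin (3 + 1)) ℝ}
    (hQ₂₀ : ∀ B : ℕ, (Q₂₀ B) = (perF (M' B) (bhKStepSh 3 Lc (Dsh Lc) (lev 0))).submatrix (fun a : (κ B) => (((pμ' B) a, Sum.inr ((mμ' B) a)) : Idx (M' B) (Fib 3)))
        (fun b : ↥(pbox (M' B)) × Fin (3 + 1) => ((b.1, Sum.inl b.2) : Idx (M' B) (Fib 3))))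
    {W₀ : ∀ B : ℕ, Matrix (↥(pbox (towerTorus Lc (M' B) (n + 1))) × Fin (3 + 1)) (NParam Lc (M' B) (fun _ : ℕ => ctrOff (3 + 1) Lc) (n + 1)) ℝ}
    (hW₀ : ∀ B : ℕ, (W₀ B) = towerGen Lc (M' B) (fun _ : ℕ => ctrOff (3 + 1) Lc) (n + 1))
    {P : ∀ B : ℕ, Matrix (NParam Lc (M' B) (fun _ : ℕ => ctrOff (3 + 1) Lc) (n + 1)) (↥(pbox (towerTorus Lc (M' B) (n + 1))) × Fin (3 + 1)) ℝ}
    (hP : ∀ B : ℕ, (P B) = bigP Lc (M' B) (fun _ : ℕ => ctrOff (3 + 1) Lc) (fun _ => toSite_mem_range (ctrOff_mem_box (d := 3 + 1) (Nat.one_le_iff_ne_zero.mpr (NeZero.ne Lc)))) (n + 1))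
    -- the step constant of the chart transport (#21's `c`), the (COV-m) order-0 image PINNED, the one-shot resolvent words and `𝔔₀` NAMED (#21 VERBATIM)
    (c : ℝ) {Dbar : ∀ B : ℕ, Matrix (↥(pbox (M' B)) × Fin (3 + 1)) (Res (toSite (ctrOff (3 + 1) Lc)) Lc (M' B)) ℝ}
    (hDbar : ∀ B : ℕ, (Dbar B) = (∏ i ∈ range (n + 1), (stepScale 3 Lc (lev (i + 1)) * ((box (3 + 1) Lc).card : ℝ))) •
        (tgrad (M' B)).submatrix (fun a : (↥(pbox (M' B)) × Fin (3 + 1)) => ((a.1, Sum.inl a.2) : Idx (M' B) (Fib 3))) (fun t : (Res (toSite (ctrOff (3 + 1) Lc)) Lc (M' B)) => (t.1 : ↥(pbox (M' B)))))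
    {Γ : ∀ B : ℕ, Matrix (↥(pbox (towerTorus Lc (M' B) (n + 1))) × Fin (3 + 1)) (↥(pbox (towerTorus Lc (M' B) (n + 1))) × Fin (3 + 1)) ℝ}
    {I : ∀ B : ℕ, Matrix (↥(pbox (towerTorus Lc (M' B) (n + 1))) × Fin (3 + 1)) ((↥(pbox (M' B)) × Fin (3 + 1)) ⊕ (NParam Lc (fine Lc (M' B)) (fun k => (fun _ : ℕ => ctrOff (3 + 1) Lc) (k + 1)) n)) ℝ}
    {L : ∀ B : ℕ, Matrix ((↥(pbox (M' B)) × Fin (3 + 1)) ⊕ (NParam Lc (fine Lc (M' B)) (fun k => (fun _ : ℕ => ctrOff (3 + 1) Lc) (k + 1)) n)) (↥(pbox (towerTorus Lc (M' B) (n + 1))) × Fin (3 + 1)) ℝ}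
    {S : ∀ B : ℕ, Matrix ((↥(pbox (M' B)) × Fin (3 + 1)) ⊕ (NParam Lc (fine Lc (M' B)) (fun k => (fun _ : ℕ => ctrOff (3 + 1) Lc) (k + 1)) n)) ((↥(pbox (M' B)) × Fin (3 + 1)) ⊕ (NParam Lc (fine Lc (M' B)) (fun k => (fun _ : ℕ => ctrOff (3 + 1) Lc) (k + 1)) n)) ℝ}
    (hΓ : ∀ B : ℕ, flucCov (H₀ B) (fromRows (Q₁₀ B) (τ₁ B)) = (Γ B)) (hI : ∀ B : ℕ, minOp (H₀ B) (fromRows (Q₁₀ B) (τ₁ B)) = (I B))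
    (hL : ∀ B : ℕ, minOpL (H₀ B) (fromRows (Q₁₀ B) (τ₁ B)) = (L B)) (hS : ∀ B : ℕ, effForm (H₀ B) (fromRows (Q₁₀ B) (τ₁ B)) = (S B))
    {𝔔₀ : ∀ B : ℕ, Matrix (κ B) (↥(pbox (towerTorus Lc (M' B) (n + 1))) × Fin (3 + 1)) ℝ} (h𝔔₀ : ∀ B : ℕ, (Q₂₀ B) * (Q₁₀ B) = (𝔔₀ B))
    -- the direction module FIXED (R-FP-72, SPEC-45 v1.6 §A row 6): directions = TOP one-shot SOURCE weights `v : κ B → ℝ`; finest-level direction `hv B v` PINNED to the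
    -- NESTED COMPOSITE COLUMN `I · (minOp S₁₁ [Q₂₀; τ₂] · (v, 0), 0)` (leaf-06 G-5's `h`); tree-gauge ∕ top-generator read-outs `lv Xbf` DISPLAYED (linear; enter the one-shot namings only)
    {hv : ∀ B : ℕ, (κ B → ℝ) → ((↥(pbox (towerTorus Lc (M' B) (n + 1))) × Fin (3 + 1)) → ℝ)}
    (hhv : ∀ B : ℕ, ∀ v, (hv B) v = (I B) *ᵥ Sum.elim (minOp (S B).toBlocks₁₁ (fromRows (Q₂₀ B) (τ₂ B)) *ᵥ Sum.elim v 0) 0)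
    (lv : ∀ B : ℕ, (κ B → ℝ) → (↥(pbox (towerTorus Lc (M' B) (n + 1))) → ℝ))
    (hlv : ∀ B : ℕ, ∀ (r : ℝ) (x y : (κ B → ℝ)), (lv B) (r • x + y) = r • (lv B) x + (lv B) y) (Xbf : ∀ B : ℕ, (κ B → ℝ) → Matrix (κ B) (κ B) ℝ)
    (hXbf : ∀ B : ℕ, ∀ (r : ℝ) (x y : (κ B → ℝ)), (Xbf B) (r • x + y) = r • (Xbf B) x + (Xbf B) y)
    -- #21's displayed jets AS FUNCTIONS of the direction: first order linear, second order in two slots (linear in each; the door reads the diagonal)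
    (H₁f : ∀ B : ℕ, (κ B → ℝ) → Matrix (↥(pbox (towerTorus Lc (M' B) (n + 1))) × Fin (3 + 1)) (↥(pbox (towerTorus Lc (M' B) (n + 1))) × Fin (3 + 1)) ℝ)
    (hH₁l : ∀ B : ℕ, ∀ (r : ℝ) (x y : (κ B → ℝ)), (H₁f B) (r • x + y) = r • (H₁f B) x + (H₁f B) y)
    {Q₁₁f : ∀ B : ℕ, (κ B → ℝ) → Matrix (↥(pbox (M' B)) × Fin (3 + 1)) (↥(pbox (towerTorus Lc (M' B) (n + 1))) × Fin (3 + 1)) ℝ}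
    (hQ₁₁f : ∀ B : ℕ, ∀ v, (Q₁₁f B) v = c • compIns₁Sym Lc (M' B) lev (fun _ : ℕ => ctrOff (3 + 1) Lc) (n + 1) ((hv B) v))
    {Q₂₁f : ∀ B : ℕ, (κ B → ℝ) → Matrix (κ B) (↥(pbox (M' B)) × Fin (3 + 1)) ℝ}
    (hQ₂₁f : ∀ B : ℕ, ∀ v, (Q₂₁f B) v = ∑ a' : (↥(pbox (M' B)) × Fin (3 + 1)), ((c * (((Lc : ℝ) ^ (3 + 1) * stepScale 3 Lc (lev 0)) * (∏ i ∈ range (n + 1), (stepScale 3 Lc (lev (i + 1)) * ((box (3 + 1) Lc).card : ℝ)))⁻¹)) * (compRowsSym Lc (M' B) lev (fun _ : ℕ => ctrOff (3 + 1) Lc) (n + 1) *ᵥ ((hv B) v)) a') • (perF (M' B) (dper (M' B) (symVhSAt (ctr (3 + 1) Lc) 3 Lc rfl a'.2 (a'.1 : Site (3 + 1))))).submatrix (fun k : κ B => ((((pμ' B) k, Sum.inr ((mμ' B) k)) : Idx (M' B) (Fib 3)))) (fun b : (↥(pbox (M' B)) × Fin (3 + 1)) => ((b.1, Sum.inl b.2)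 : Idx (M' B) (Fib 3))))
    (H₂f : ∀ B : ℕ, (κ B → ℝ) → (κ B → ℝ) → Matrix (↥(pbox (towerTorus Lc (M' B) (n + 1))) × Fin (3 + 1)) (↥(pbox (towerTorus Lc (M' B) (n + 1))) × Fin (3 + 1)) ℝ)
    (hH₂l : ∀ B : ℕ, ∀ (r : ℝ) (x y z : (κ B → ℝ)), (H₂f B) (r • x + y) z = r • (H₂f B) x z + (H₂f B) y z)
    (hH₂r : ∀ B : ℕ, ∀ (r : ℝ) (x y z : (κ B → ℝ)), (H₂f B) z (r • x + y) = r • (H₂f B) z x + (H₂f B) z y)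
    {Q₁₂f : ∀ B : ℕ, (κ B → ℝ) → (κ B → ℝ) → Matrix (↥(pbox (M' B)) × Fin (3 + 1)) (↥(pbox (towerTorus Lc (M' B) (n + 1))) × Fin (3 + 1)) ℝ}
    (hQ₁₂f : ∀ B : ℕ, ∀ v v', (Q₁₂f B) v v' = c ^ 2 • compIns₂₂Sym Lc (M' B) lev (fun _ : ℕ => ctrOff (3 + 1) Lc) (n + 1) ((hv B) v) ((hv B) v'))
    {Q₂₂f : ∀ B : ℕ, (κ B → ℝ) → (κ B → ℝ) → Matrix (κ B) (↥(pbox (M' B)) × Fin (3 + 1)) ℝ}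
    (hQ₂₂f : ∀ B : ℕ, ∀ v v', (Q₂₂f B) v v' = ((Lc : ℝ) ^ (3 + 1) * stepScale 3 Lc (lev 0))⁻¹ •
        ∑ b : (↥(pbox (M' B)) × Fin (3 + 1)), ∑ b' : (↥(pbox (M' B)) × Fin (3 + 1)), (((c * (((Lc : ℝ) ^ (3 + 1) * stepScale 3 Lc (lev 0)) * (∏ i ∈ range (n + 1), (stepScale 3 Lc (lev (i + 1)) * ((box (3 + 1) Lc).card : ℝ)))⁻¹)) * (compRowsSym Lc (M' B) lev (fun _ : ℕ => ctrOff (3 + 1) Lc) (n + 1) *ᵥ ((hv B) v)) b) * ((c * (((Lc : ℝ) ^ (3 + 1) * stepScale 3 Lc (lev 0)) * (∏ i ∈ range (n + 1), (stepScale 3 Lc (lev (i + 1)) * ((box (3 + 1) Lc).card : ℝ)))⁻¹)) * (compRowsSym Lc (M' B) lev (fun _ : ℕ => ctrOff (3 + 1) Lc) (n + 1) *ᵥ ((hv B) v')) b')) •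
          (perF (M' B) (dper (M' B) (fun x z a e => ∑' m : Site (3 + 1), (1 / 2 : ℝ) *
            (symVh₂SAt (ctr (3 + 1) Lc) Lc b.2 (b.1 : Site (3 + 1)) b'.2 (translate (M' B) (b'.1 : Site (3 + 1)) m) x z a e
              + symVh₂SAt (ctr (3 + 1) Lc) Lc b'.2 (translate (M' B) (b'.1 : Site (3 + 1)) m) b.2 (b.1 : Site (3 + 1)) x z a e)))).submatrix
            (fun k : κ B => ((((pμ' B) k, Sum.inr ((mμ' B) k)) : Idx (M' B) (Fib 3)))) (fun b : (↥(pbox (M' B)) × Fin (3 + 1)) => ((b.1, Sum.inl b.2) : Idx (M' B) (Fib 3))))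
    -- #21's composite and one-shot NAMINGS as functions (`h𝔔₁ h𝔔₂ k1 k2 q1 q2`; `X := −(c • diagonal (λ ∘ pr))` at `λ := lv v`; order 2 in two slots)
    (𝔔₁f : ∀ B : ℕ, (κ B → ℝ) → Matrix (κ B) (↥(pbox (towerTorus Lc (M' B) (n + 1))) × Fin (3 + 1)) ℝ)
    (h𝔔₁ : ∀ B : ℕ, ∀ v, (Q₂₁f B) v * (Q₁₀ B) + (Q₂₀ B) * (Q₁₁f B) v = (𝔔₁f B) v)
    (𝔔₂f : ∀ B : ℕ, (κ B → ℝ) → (κ B → ℝ) → Matrix (κ B) (↥(pbox (towerTorus Lc (M' B) (n + 1))) × Fin (3 + 1)) ℝ)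
    (h𝔔₂ : ∀ B : ℕ, ∀ v v', (Q₂₂f B) v v' * (Q₁₀ B) + (Q₂₁f B) v * (Q₁₁f B) v' + ((Q₂₁f B) v * (Q₁₁f B) v' + (Q₂₀ B) * (Q₁₂f B) v v') = (𝔔₂f B) v v')
    (H'₁f : ∀ B : ℕ, (κ B → ℝ) → Matrix (↥(pbox (towerTorus Lc (M' B) (n + 1))) × Fin (3 + 1)) (↥(pbox (towerTorus Lc (M' B) (n + 1))) × Fin (3 + 1)) ℝ)
    (hH'₁f : ∀ B : ℕ, ∀ v, (H'₁f B) v = -((-(c • Matrix.diagonal (fun b : (↥(pbox (towerTorus Lc (M' B) (n + 1))) × Fin (3 + 1)) => (lv B) v b.1)))ᵀ * (H₀ B)) + (H₁f B) v + (H₀ B) * (-(c • Matrix.diagonal (fun b : (↥(pbox (towerTorus Lc (M' B) (n + 1))) × Fin (3 + 1)) => (lv B) v b.1))))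
    (H'₂f : ∀ B : ℕ, (κ B → ℝ) → (κ B → ℝ) → Matrix (↥(pbox (towerTorus Lc (M' B) (n + 1))) × Fin (3 + 1)) (↥(pbox (towerTorus Lc (M' B) (n + 1))) × Fin (3 + 1)) ℝ)
    (hH'₂f : ∀ B : ℕ, ∀ v v', (H'₂f B) v v' = ((-(c • Matrix.diagonal (fun b : (↥(pbox (towerTorus Lc (M' B) (n + 1))) × Fin (3 + 1)) => (lv B) v b.1))) * (-(c • Matrix.diagonal (fun b : (↥(pbox (towerTorus Lc (M' B) (n + 1))) × Fin (3 + 1)) => (lv B) v' b.1))))ᵀ * (H₀ B) + (-((-(c • Matrix.diagonal (fun b : (↥(pbox (towerTorus Lc (M' B) (n + 1))) × Fin (3 + 1)) => (lv B) v b.1)))ᵀ * (H₁f B) v') + -((-(c • Matrix.diagonal (fun b : (↥(pbox (towerTorus Lc (M' B) (n + 1))) × Fin (3 + 1)) => (lv B) v b.1)))ᵀ * (H₀ B) * (-(c • Matrix.diagonal (fun b : (↥(pbox (towerTorus Lc (M' B) (n + 1))) × Fin (3 + 1)) => (lv B) v' b.1)))))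
      + ((-((-(c • Matrix.diagonal (fun b : (↥(pbox (towerTorus Lc (M' B) (n + 1))) × Fin (3 + 1)) => (lv B) v b.1)))ᵀ * (H₁f B) v') + -((-(c • Matrix.diagonal (fun b : (↥(pbox (towerTorus Lc (M' B) (n + 1))) × Fin (3 + 1)) => (lv B) v b.1)))ᵀ * (H₀ B) * (-(c • Matrix.diagonal (fun b : (↥(pbox (towerTorus Lc (M' B) (n + 1))) × Fin (3 + 1)) => (lv B) v' b.1))))) + ((H₂f B) v v' + (H₁f B) v * (-(c • Matrix.diagonal (fun b : (↥(pbox (towerTorus Lc (M' B) (n + 1))) × Fin (3 + 1)) => (lv B) v' b.1))) + ((H₁f B) v * (-(c • Matrix.diagonal (fun b : (↥(pbox (towerTorus Lc (M' B) (n + 1))) × Fin (3 + 1)) => (lv B) v' b.1))) + (H₀ B) * ((-(c • Matrix.diagonal (fun b : (↥(pbox (towerTorus Lc (M' B) (n + 1))) × Fin (3 + 1)) => (lv B) v b.1))) * (-(c • Matrix.diagonal (fun b : (↥(pbox (towerTorus Lc (M' B) (n + 1))) × Fin (3 + 1)) => (lv B) v' b.1))))))))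
    (𝔔'₁f : ∀ B : ℕ, (κ B → ℝ) → Matrix (κ B) (↥(pbox (towerTorus Lc (M' B) (n + 1))) × Fin (3 + 1)) ℝ)
    (h𝔔'₁f : ∀ B : ℕ, ∀ v, (𝔔'₁f B) v = (Xbf B) v * (𝔔₀ B) + (𝔔₁f B) v + (𝔔₀ B) * (-(c • Matrix.diagonal (fun b : (↥(pbox (towerTorus Lc (M' B) (n + 1))) × Fin (3 + 1)) => (lv B) v b.1))))
    (𝔔'₂f : ∀ B : ℕ, (κ B → ℝ) → (κ B → ℝ) → Matrix (κ B) (↥(pbox (towerTorus Lc (M' B) (n + 1))) × Fin (3 + 1)) ℝ)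
    (h𝔔'₂f : ∀ B : ℕ, ∀ v v', (𝔔'₂f B) v v' = (Xbf B) v * (Xbf B) v' * (𝔔₀ B) + ((Xbf B) v * (𝔔₁f B) v' + (Xbf B) v * (𝔔₀ B) * (-(c • Matrix.diagonal (fun b : (↥(pbox (towerTorus Lc (M' B) (n + 1))) × Fin (3 + 1)) => (lv B) v' b.1))))
      + (((Xbf B) v * (𝔔₁f B) v' + (Xbf B) v * (𝔔₀ B) * (-(c • Matrix.diagonal (fun b : (↥(pbox (towerTorus Lc (M' B) (n + 1))) × Fin (3 + 1)) => (lv B) v' b.1)))) + ((𝔔₂f B) v v' + (𝔔₁f B) v * (-(c • Matrix.diagonal (fun b : (↥(pbox (towerTorus Lc (M' B) (n + 1))) × Fin (3 + 1)) => (lv B) v' b.1))) + ((𝔔₁f B) v * (-(c • Matrix.diagonal (fun b : (↥(pbox (towerTorus Lc (M' B) (n + 1))) × Fin (3 + 1)) => (lv B) v' b.1))) + (𝔔₀ B) * ((-(c • Matrix.diagonal (fun b : (↥(pbox (towerTorus Lc (M' B) (n + 1))) × Fin (3 + 1)) => (lv B) v b.1))) * (-(c • Matrix.diagonal (fun b :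 (↥(pbox (towerTorus Lc (M' B) (n + 1))) × Fin (3 + 1)) => (lv B) v' b.1))))))))
    -- #21's generator jets by their closed forms at `h := hv v` (weight `h`), per direction
    (W₁f W₂f : ∀ B : ℕ, (κ B → ℝ) → Matrix (↥(pbox (towerTorus Lc (M' B) (n + 1))) × Fin (3 + 1)) (NParam Lc (M' B) (fun _ : ℕ => ctrOff (3 + 1) Lc) (n + 1)) ℝ)
    (hW₁f : ∀ B : ℕ, ∀ v, (W₁f B) v = Matrix.of fun (b : (↥(pbox (towerTorus Lc (M' B) (n + 1))) × Fin (3 + 1))) (e : (NParam Lc (M' B) (fun _ : ℕ => ctrOff (3 + 1) Lc) (n + 1))) => -(c * (hv B) v b * evalN Lc (M' B) (fun _ : ℕ => ctrOff (3 + 1) Lc) (n + 1) (fun b' : (↥(pbox (towerTorus Lc (M' B) (n + 1))) × Fin (3 + 1)) => (b'.1 : Site (3 + 1)) + unitVec b'.2) b e))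
    (hW₂f : ∀ B : ℕ, ∀ v, (W₂f B) v = Matrix.of fun (b : (↥(pbox (towerTorus Lc (M' B) (n + 1))) × Fin (3 + 1))) (e : (NParam Lc (M' B) (fun _ : ℕ => ctrOff (3 + 1) Lc) (n + 1))) => (c * (hv B) v b) ^ 2 * evalN Lc (M' B) (fun _ : ℕ => ctrOff (3 + 1) Lc) (n + 1) (fun b' : (↥(pbox (towerTorus Lc (M' B) (n + 1))) × Fin (3 + 1)) => (b'.1 : Site (3 + 1)) + unitVec b'.2) b e)
    -- the (COV-m) order-1∕2 images PINNED (leaf-02 R-22 ∕ R-27's `D̄₁ D̄₂`: tip-type jets of the transported direction `compRowsSym · hv B v`); the (WARD-m) sources free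
    {Db₁f Db₂f : ∀ B : ℕ, (κ B → ℝ) → Matrix (↥(pbox (M' B)) × Fin (3 + 1)) (Res (toSite (ctrOff (3 + 1) Lc)) Lc (M' B)) ℝ}
    (hDb₁f : ∀ B : ℕ, ∀ v, (Db₁f B) v = Matrix.of fun (a : (↥(pbox (M' B)) × Fin (3 + 1))) (t : (Res (toSite (ctrOff (3 + 1) Lc)) Lc (M' B))) => -(c * (compRowsSym Lc (M' B) lev (fun _ : ℕ => ctrOff (3 + 1) Lc) (n + 1) *ᵥ ((hv B) v)) a * tdelta (M' B) ((a.1 : Site (3 + 1)) + unitVec a.2) t.1))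
    (hDb₂f : ∀ B : ℕ, ∀ v, (Db₂f B) v = Matrix.of fun (a : (↥(pbox (M' B)) × Fin (3 + 1))) (t : (Res (toSite (ctrOff (3 + 1) Lc)) Lc (M' B))) => (c ^ 2 * (∏ i ∈ range (n + 1), (stepScale 3 Lc (lev (i + 1)) * ((box (3 + 1) Lc).card : ℝ)))⁻¹) * ((compRowsSym Lc (M' B) lev (fun _ : ℕ => ctrOff (3 + 1) Lc) (n + 1) *ᵥ ((hv B) v)) a) ^ 2 * tdelta (M' B) ((a.1 : Site (3 + 1)) + unitVec a.2) t.1)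
    (Y₁f Y₂f : ∀ B : ℕ, (κ B → ℝ) → Matrix (κ B) (NParam Lc (M' B) (fun _ : ℕ => ctrOff (3 + 1) Lc) (n + 1)) ℝ)
    -- the `G`-side DRESSED WORDS, NAMED (#36b's shapes at `B := [Q₁₁f v; 0]`)
    (Gw₁f : ∀ B : ℕ, (κ B → ℝ) → Matrix (↥(pbox (M' B)) × Fin (3 + 1)) (↥(pbox (M' B)) × Fin (3 + 1)) ℝ)
    (hGw₁f : ∀ B : ℕ, ∀ v, (Gw₁f B) v = (((L B) * ((H₁f B) v) - (S B) * (fromRows ((Q₁₁f B) v) (0 : Matrix (NParam Lc (fine Lc (M' B)) (fun k => (fun _ : ℕ => ctrOff (3 + 1) Lc) (k + 1)) n) (↥(pbox (towerTorus Lc (M' B) (n + 1))) × Fin (3 + 1)) ℝ))) * (I B) + (L B) * (fromRows ((Q₁₁f B) v) (0 : Matrix (NParam Lc (fine Lc (M' B)) (fun k => (fun _ : ℕ => ctrOff (3 + 1) Lc) (k + 1)) n) (↥(pbox (towerTorus Lc (M' B) (n + 1))) × Fin (3 + 1)) ℝ))ᵀ * (S B)).toBlocks₁₁)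
    (Gw₂f : ∀ B : ℕ, (κ B → ℝ) → (κ B → ℝ) → Matrix (↥(pbox (M' B)) × Fin (3 + 1)) (↥(pbox (M' B)) × Fin (3 + 1)) ℝ)
    (hGw₂f : ∀ B : ℕ, ∀ v v', (Gw₂f B) v v' =
      ((((-(((L B) * ((H₁f B) v) - (S B) * (fromRows ((Q₁₁f B) v) (0 : Matrix (NParam Lc (fine Lc (M' B)) (fun k => (fun _ : ℕ => ctrOff (3 + 1) Lc) (k + 1)) n) (↥(pbox (towerTorus Lc (M' B) (n + 1))) × Fin (3 + 1)) ℝ))) * (Γ B) - (L B) * (fromRows ((Q₁₁f B) v) (0 : Matrix (NParam Lc (fine Lc (M' B)) (fun k => (fun _ : ℕ => ctrOff (3 + 1) Lc) (k + 1)) n) (↥(pbox (towerTorus Lc (M' B) (n + 1))) × Fin (3 + 1)) ℝ))ᵀ * (L B)) * ((H₁f B) v') + (L B) * ((H₂f B) v v')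
          - ((((L B) * ((H₁f B) v) - (S B) * (fromRows ((Q₁₁f B) v) (0 : Matrix (NParam Lc (fine Lc (M' B)) (fun k => (fun _ : ℕ => ctrOff (3 + 1) Lc) (k + 1)) n) (↥(pbox (towerTorus Lc (M' B) (n + 1))) × Fin (3 + 1)) ℝ))) * (I B) + (L B) * (fromRows ((Q₁₁f B) v) (0 : Matrix (NParam Lc (fine Lc (M' B)) (fun k => (fun _ : ℕ => ctrOff (3 + 1) Lc) (k + 1)) n) (↥(pbox (towerTorus Lc (M' B) (n + 1))) × Fin (3 + 1)) ℝ))ᵀ * (S B)) * (fromRows ((Q₁₁f B) v') (0 : Matrix (NParam Lc (fine Lc (M' B)) (fun k => (fun _ : ℕ => ctrOff (3 + 1) Lc) (k + 1)) n) (↥(pbox (towerTorus Lc (M' B) (n + 1))) × Fin (3 + 1)) ℝ)) + (S B) * (fromRows ((Q₁₂f B) v v') (0 : Matrix (NParam Lc (fine Lc (M' B)) (fun k => (fun _ : ℕ => ctrOff (3 + 1) Lc) (k + 1)) n) (↥(pbox (towerTorus Lc (M' B) (n + 1))) × Fin (3 + 1)) ℝ)))) * (I B)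
        + ((L B) * ((H₁f B) v) - (S B) * (fromRows ((Q₁₁f B) v) (0 : Matrix (NParam Lc (fine Lc (M' B)) (fun k => (fun _ : ℕ => ctrOff (3 + 1) Lc) (k + 1)) n) (↥(pbox (towerTorus Lc (M' B) (n + 1))) × Fin (3 + 1)) ℝ))) * (-(((Γ B) * ((H₁f B) v') + (I B) * (fromRows ((Q₁₁f B) v') (0 : Matrix (NParam Lc (fine Lc (M' B)) (fun k => (fun _ : ℕ => ctrOff (3 + 1) Lc) (k + 1)) n) (↥(pbox (towerTorus Lc (M' B) (n + 1))) × Fin (3 + 1)) ℝ))) * (I B) + (Γ B) * (fromRows ((Q₁₁f B) v') (0 : Matrix (NParam Lc (fine Lc (M' B)) (fun k => (fun _ : ℕ => ctrOff (3 + 1) Lc) (k + 1)) n) (↥(pbox (towerTorus Lc (M' B) (n + 1))) × Fin (3 + 1)) ℝ))ᵀ * (S B))))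
      - ((-(((L B) * ((H₁f B) v) - (S B) * (fromRows ((Q₁₁f B) v) (0 : Matrix (NParam Lc (fine Lc (M' B)) (fun k => (fun _ : ℕ => ctrOff (3 + 1) Lc) (k + 1)) n) (↥(pbox (towerTorus Lc (M' B) (n + 1))) × Fin (3 + 1)) ℝ))) * (Γ B) - (L B) * (fromRows ((Q₁₁f B) v) (0 : Matrix (NParam Lc (fine Lc (M' B)) (fun k => (fun _ : ℕ => ctrOff (3 + 1) Lc) (k + 1)) n) (↥(pbox (towerTorus Lc (M' B) (n + 1))) × Fin (3 + 1)) ℝ))ᵀ * (L B)) * (-(fromRows ((Q₁₁f B) v') (0 : Matrix (NParam Lc (fine Lc (M' B)) (fun k => (fun _ : ℕ => ctrOff (3 + 1) Lc) (k + 1)) n) (↥(pbox (towerTorus Lc (M' B) (n + 1))) × Fin (3 + 1)) ℝ))ᵀ) + (L B) * (fromRows ((Q₁₂f B) v v') (0 : Matrix (NParam Lc (fine Lc (M' B)) (fun k => (fun _ : ℕ => ctrOff (3 + 1) Lc) (k + 1)) n) (↥(pbox (towerTorus Lc (M' B) (n + 1))) × Fin (3 + 1)) ℝ))ᵀ) *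 (S B)
          + (L B) * (-(fromRows ((Q₁₁f B) v) (0 : Matrix (NParam Lc (fine Lc (M' B)) (fun k => (fun _ : ℕ => ctrOff (3 + 1) Lc) (k + 1)) n) (↥(pbox (towerTorus Lc (M' B) (n + 1))) × Fin (3 + 1)) ℝ))ᵀ) * (((L B) * ((H₁f B) v') - (S B) * (fromRows ((Q₁₁f B) v') (0 : Matrix (NParam Lc (fine Lc (M' B)) (fun k => (fun _ : ℕ => ctrOff (3 + 1) Lc) (k + 1)) n) (↥(pbox (towerTorus Lc (M' B) (n + 1))) × Fin (3 + 1)) ℝ))) * (I B) + (L B) * (fromRows ((Q₁₁f B) v') (0 : Matrix (NParam Lc (fine Lc (M' B)) (fun k => (fun _ : ℕ => ctrOff (3 + 1) Lc) (k + 1)) n) (↥(pbox (towerTorus Lc (M' B) (n + 1))) × Fin (3 + 1)) ℝ))ᵀ * (S B))))).toBlocks₁₁)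
    -- #21's H-SIDE ROWS, FOR EVERY DIRECTION — DISPLAYED (R-FP-74∕75: `H₁f ∕ H₂f` are the TOTAL graded slots; their naming is the row's (C1) Hessian-table word): form parities, graded Ward rows
    (hH₁t : ∀ B : ℕ, ∀ v, ((H₁f B) v)ᵀ = -(H₁f B) v) (hH₂t : ∀ B : ℕ, ∀ v, ((H₂f B) v v)ᵀ = (H₂f B) v v)
    (a1 : ∀ B : ℕ, ∀ v, (H₁f B) v * (W₀ B) + (H₀ B) * (W₁f B) v = (𝔔₀ B)ᵀ * (Y₁f B) v)
    (a2 : ∀ B : ℕ, ∀ v, (H₂f B) v v * (W₀ B) + (2 : ℝ) • ((H₁f B) v * (W₁f B) v) + (H₀ B) * (W₂f B) v = -((2 : ℝ) • (((𝔔₁f B) v)ᵀ * (Y₁f B) v)) + (𝔔₀ B)ᵀ * (Y₂f B) v)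
    -- a finite family of direction LABELS (box-free) read in every box's direction module, and the pair bound to the base points `(μ, 0)`, `(ν, z)`
    {σ : Type*} [Fintype σ] [DecidableEq σ] (dv : ∀ B : ℕ, σ → (κ B → ℝ)) (a₁ a₂ : σ)
    -- (S3-1) N — per box: the ONE-SHOT system of depth `n+2`, right inverse and LEG over the box-free chart kernel `A_N` under the torus rules (DISPLAYED);
    -- (P2‴)'s lattice letters of `A_N`: decay + blocking-`Lc^(n+2)` covariance (#42a VERBATIM)
    {XN : ∀ B : ℕ, Matrix ((↥(pbox (towerTorus Lc (M' B) (n + 1))) × Fin (3 + 1)) ⊕ (κ B ⊕ (NParam Lc (M' B) (fun _ : ℕ => ctrOff (3 + 1) Lc) (n + 1)))) ((↥(pbox (towerTorus Lc (M' B) (n + 1))) × Fin (3 + 1)) ⊕ (κ B ⊕ (NParam Lc (M' B) (fun _ : ℕ => ctrOff (3 + 1) Lc) (n + 1)))) ℝ}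
    (hXN : ∀ B : ℕ, kkt (H₀ B) (fromRows (𝔔₀ B) (P B)) * XN B = 1) (ρN : Fin (3 + 1) → ℤ) (LNc : ℕ)
    (fN : ∀ B : ℕ, κ B → Idx (towerTorus Lc (M' B) (n + 1)) (Fib 3)) (hfN : ∀ B : ℕ, Function.Injective (fN B))
    (hmN : ∀ B : ℕ, ∀ a : κ B, ∃ m : Fin (3 + 1), (fN B a).2 = Sum.inr m)
    (hcN : ∀ B : ℕ, ∀ (s : ↥(pbox (towerTorus Lc (M' B) (n + 1)))) (m : Fin (3 + 1)), ((s, Sum.inr m) : Idx (towerTorus Lc (M' B) (n + 1)) (Fib 3)) ∈ Set.range (fN B) ↔ Torus.proj LNc (s : Site (3 + 1)) = 0)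
    {AN : MKer (3 + 1) (Fib 3)} {CAN αN : ℝ} (hAN : Decays AN CAN αN) (hαN : 0 < αN)
    (hANsh : ∀ t : Fin (3 + 1) → ℤ, shiftK (((Lc ^ (n + 2) : ℕ) : ℤ) • t) AN = AN)
    (hEAN : ∀ B : ℕ, perF (towerTorus Lc (M' B) (n + 1)) (axEc ρN LNc) * perF (towerTorus Lc (M' B) (n + 1)) AN = perF (towerTorus Lc (M' B) (n + 1)) AN)
    (hAEN : ∀ B : ℕ, perF (towerTorus Lc (M' B) (n + 1)) AN * perF (towerTorus Lc (M' B) (n + 1)) (axEc ρN LNc) = perF (towerTorus Lc (M' B) (n + 1)) AN)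
    (hLN : ∀ B : ℕ, (XN B).submatrix (Sum.map id Sum.inl) (Sum.map id Sum.inl) = fromBlocks
      (Matrix.of fun (b b' : (↥(pbox (towerTorus Lc (M' B) (n + 1))) × Fin (3 + 1))) =>
        axEc ρN LNc (b.1 : Site (3 + 1)) (b.1 : Site (3 + 1)) (Sum.inl b.2) (Sum.inl b.2)
          * (axEc ρN LNc (b'.1 : Site (3 + 1)) (b'.1 : Site (3 + 1)) (Sum.inl b'.2) (Sum.inl b'.2) * perF (towerTorus Lc (M' B) (n + 1)) AN (b.1, Sum.inl b.2) (b'.1, Sum.inl b'.2)))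
      (Matrix.of fun (b : (↥(pbox (towerTorus Lc (M' B) (n + 1))) × Fin (3 + 1))) (a : κ B) =>
        axEc ρN LNc (b.1 : Site (3 + 1)) (b.1 : Site (3 + 1)) (Sum.inl b.2) (Sum.inl b.2) * perF (towerTorus Lc (M' B) (n + 1)) AN (b.1, Sum.inl b.2) ((fN B) a))
      (-Matrix.of fun (a : κ B) (b : (↥(pbox (towerTorus Lc (M' B) (n + 1))) × Fin (3 + 1))) =>
        axEc ρN LNc (b.1 : Site (3 + 1)) (b.1 : Site (3 + 1)) (Sum.inl b.2) (Sum.inl b.2) * perF (towerTorus Lc (M' B) (n + 1)) AN ((fN B) a) (b.1, Sum.inl b.2))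
      (-((perF (towerTorus Lc (M' B) (n + 1)) AN).submatrix (fN B) (fN B))))
    -- (S3-2) N — the lattice base-point jets `𝒱_N (μ,0)`, `𝒱_N (ν,z)`, `𝒲_N (μ,0;ν,z)`: bi-localised ((P2‴)), and PER BOX their periodisations carry the
    -- parities and ARE the door's `N` jets in the directions `a₁ a₂` on the blocks (the (C1) namings DISPLAYED) (#42a VERBATIM)
    {pN pN' qN qN' : Fin (3 + 1) → ℤ} {CvN CvN' CwN δN : ℝ} (hVN : BiLoc (𝒱N μ 0) pN pN' CvN δN) (hVN' : BiLoc (𝒱N ν z) qN' qN CvN' δN)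
    (hWN : BiLoc (𝒲N μ 0 ν z) pN qN CwN δN) (hδN : 0 < δN)
    (hVNm : ∀ B : ℕ, ∀ a a' : κ B, (perF (towerTorus Lc (M' B) (n + 1)) (dper (towerTorus Lc (M' B) (n + 1)) (𝒱N μ 0))) ((fN B) a) ((fN B) a') = 0)
    (hVNt : ∀ B : ℕ, ∀ (b : (↥(pbox (towerTorus Lc (M' B) (n + 1))) × Fin (3 + 1))) (a : κ B), (perF (towerTorus Lc (M' B) (n + 1)) (dper (towerTorus Lc (M' B) (n + 1)) (𝒱N μ 0))) (b.1, Sum.inl b.2) ((fN B) a) = (perF (towerTorus Lc (M' B) (n + 1)) (dper (towerTorus Lc (M' B) (n + 1)) (𝒱N μ 0))) ((fN B) a) (b.1, Sum.inl b.2))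
    (hVN'm : ∀ B : ℕ, ∀ a a' : κ B, (perF (towerTorus Lc (M' B) (n + 1)) (dper (towerTorus Lc (M' B) (n + 1)) (𝒱N ν z))) ((fN B) a) ((fN B) a') = 0)
    (hVN't : ∀ B : ℕ, ∀ (b : (↥(pbox (towerTorus Lc (M' B) (n + 1))) × Fin (3 + 1))) (a : κ B), (perF (towerTorus Lc (M' B) (n + 1)) (dper (towerTorus Lc (M' B) (n + 1)) (𝒱N ν z))) (b.1, Sum.inl b.2) ((fN B) a) = (perF (towerTorus Lc (M' B) (n + 1)) (dper (towerTorus Lc (M' B) (n + 1)) (𝒱N ν z))) ((fN B) a) (b.1, Sum.inl b.2))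
    (hWNm : ∀ B : ℕ, ∀ a a' : κ B, (perF (towerTorus Lc (M' B) (n + 1)) (dper (towerTorus Lc (M' B) (n + 1)) (𝒲N μ 0 ν z))) ((fN B) a) ((fN B) a') = 0)
    (hWNt : ∀ B : ℕ, ∀ (b : (↥(pbox (towerTorus Lc (M' B) (n + 1))) × Fin (3 + 1))) (a : κ B), (perF (towerTorus Lc (M' B) (n + 1)) (dper (towerTorus Lc (M' B) (n + 1)) (𝒲N μ 0 ν z))) (b.1, Sum.inl b.2) ((fN B) a) = -(perF (towerTorus Lc (M' B) (n + 1)) (dper (towerTorus Lc (M' B) (n + 1)) (𝒲N μ 0 ν z))) ((fN B) a) (b.1, Sum.inl b.2))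
    (hHN₁ : ∀ B : ℕ, H'₁f B (dv B a₁) = (perF (towerTorus Lc (M' B) (n + 1)) (dper (towerTorus Lc (M' B) (n + 1)) (𝒱N μ 0))).submatrix (fun b : (↥(pbox (towerTorus Lc (M' B) (n + 1))) × Fin (3 + 1)) => ((b.1, Sum.inl b.2) : Idx (towerTorus Lc (M' B) (n + 1)) (Fib 3))) (fun b : (↥(pbox (towerTorus Lc (M' B) (n + 1))) × Fin (3 + 1)) => ((b.1, Sum.inl b.2) : Idx (towerTorus Lc (M' B) (n + 1)) (Fib 3))))
    (hQN₁ : ∀ B : ℕ, 𝔔'₁f B (dv B a₁) = (perF (towerTorus Lc (M' B) (n + 1)) (dper (towerTorus Lc (M' B) (n + 1)) (𝒱N μ 0))).submatrix (fN B) (fun b : (↥(pbox (towerTorus Lc (M' B) (n + 1))) × Fin (3 + 1)) => ((b.1, Sum.inl b.2) : Idx (towerTorus Lc (M' B) (n + 1)) (Fib 3))))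
    (hHN₁' : ∀ B : ℕ, H'₁f B (dv B a₂) = (perF (towerTorus Lc (M' B) (n + 1)) (dper (towerTorus Lc (M' B) (n + 1)) (𝒱N ν z))).submatrix (fun b : (↥(pbox (towerTorus Lc (M' B) (n + 1))) × Fin (3 + 1)) => ((b.1, Sum.inl b.2) : Idx (towerTorus Lc (M' B) (n + 1)) (Fib 3))) (fun b : (↥(pbox (towerTorus Lc (M' B) (n + 1))) × Fin (3 + 1)) => ((b.1, Sum.inl b.2) : Idx (towerTorus Lc (M' B) (n + 1)) (Fib 3))))
    (hQN₁' : ∀ B : ℕ, 𝔔'₁f B (dv B a₂) = (perF (towerTorus Lc (M' B) (n + 1)) (dper (towerTorus Lc (M' B) (n + 1)) (𝒱N ν z))).submatrix (fN B) (fun b : (↥(pbox (towerTorus Lc (M' B) (n + 1))) × Fin (3 + 1)) => ((b.1, Sum.inl b.2) : Idx (towerTorus Lc (M' B) (n + 1)) (Fib 3))))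
    (hHN₂ : ∀ B : ℕ, (1 / 2 : ℝ) • (H'₂f B (dv B a₁) (dv B a₂) + H'₂f B (dv B a₂) (dv B a₁)) = (perF (towerTorus Lc (M' B) (n + 1)) (dper (towerTorus Lc (M' B) (n + 1)) (𝒲N μ 0 ν z))).submatrix (fun b : (↥(pbox (towerTorus Lc (M' B) (n + 1))) × Fin (3 + 1)) => ((b.1, Sum.inl b.2) : Idx (towerTorus Lc (M' B) (n + 1)) (Fib 3))) (fun b : (↥(pbox (towerTorus Lc (M' B) (n + 1))) × Fin (3 + 1)) => ((b.1, Sum.inl b.2) : Idx (towerTorus Lc (M' B) (n + 1)) (Fib 3))))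
    (hQN₂ : ∀ B : ℕ, (1 / 2 : ℝ) • (𝔔'₂f B (dv B a₁) (dv B a₂) + 𝔔'₂f B (dv B a₂) (dv B a₁)) = (perF (towerTorus Lc (M' B) (n + 1)) (dper (towerTorus Lc (M' B) (n + 1)) (𝒲N μ 0 ν z))).submatrix (fN B) (fun b : (↥(pbox (towerTorus Lc (M' B) (n + 1))) × Fin (3 + 1)) => ((b.1, Sum.inl b.2) : Idx (towerTorus Lc (M' B) (n + 1)) (Fib 3))))
    -- (S3-1) F — per box: the ONE-SHOT system of the tower below (depth `n+1`, same finest torus), right inverse and LEG over `A_F` (DISPLAYED);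
    -- (P2‴)'s lattice letters of `A_F`: decay + blocking-`Lc^(n+1)` covariance (#42a VERBATIM)
    {XF : ∀ B : ℕ, Matrix ((↥(pbox (towerTorus Lc (M' B) (n + 1))) × Fin (3 + 1)) ⊕ ((↥(pbox (M' B)) × Fin (3 + 1)) ⊕ (NParam Lc (fine Lc (M' B)) (fun k => (fun _ : ℕ => ctrOff (3 + 1) Lc) (k + 1)) n))) ((↥(pbox (towerTorus Lc (M' B) (n + 1))) × Fin (3 + 1)) ⊕ ((↥(pbox (M' B)) × Fin (3 + 1)) ⊕ (NParam Lc (fine Lc (M' B)) (fun k => (fun _ : ℕ => ctrOff (3 + 1) Lc) (k + 1)) n))) ℝ}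
    (hXF : ∀ B : ℕ, kkt (H₀ B) (fromRows (Q₁₀ B) (τ₁ B)) * XF B = 1) (ρF : Fin (3 + 1) → ℤ) (LFc : ℕ)
    (fF : ∀ B : ℕ, (↥(pbox (M' B)) × Fin (3 + 1)) → Idx (towerTorus Lc (M' B) (n + 1)) (Fib 3)) (hfF : ∀ B : ℕ, Function.Injective (fF B))
    (hmF : ∀ B : ℕ, ∀ a : (↥(pbox (M' B)) × Fin (3 + 1)), ∃ m : Fin (3 + 1), (fF B a).2 = Sum.inr m)
    (hcF : ∀ B : ℕ, ∀ (s : ↥(pbox (towerTorus Lc (M' B) (n + 1)))) (m : Fin (3 + 1)), ((s, Sum.inr m) : Idx (towerTorus Lc (M' B) (n + 1)) (Fib 3)) ∈ Set.range (fF B) ↔ Torus.proj LFc (s : Site (3 + 1)) = 0)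
    {AF : MKer (3 + 1) (Fib 3)} {CAF αF : ℝ} (hAF : Decays AF CAF αF) (hαF : 0 < αF)
    (hAFsh : ∀ t : Fin (3 + 1) → ℤ, shiftK (((Lc ^ (n + 1) : ℕ) : ℤ) • t) AF = AF)
    (hEAF : ∀ B : ℕ, perF (towerTorus Lc (M' B) (n + 1)) (axEc ρF LFc) * perF (towerTorus Lc (M' B) (n + 1)) AF = perF (towerTorus Lc (M' B) (n + 1)) AF)
    (hAEF : ∀ B : ℕ, perF (towerTorus Lc (M' B) (n + 1)) AF * perF (towerTorus Lc (M' B) (n + 1)) (axEc ρF LFc) = perF (towerTorus Lc (M' B) (n + 1)) AF)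
    (hLF : ∀ B : ℕ, (XF B).submatrix (Sum.map id Sum.inl) (Sum.map id Sum.inl) = fromBlocks
      (Matrix.of fun (b b' : (↥(pbox (towerTorus Lc (M' B) (n + 1))) × Fin (3 + 1))) =>
        axEc ρF LFc (b.1 : Site (3 + 1)) (b.1 : Site (3 + 1)) (Sum.inl b.2) (Sum.inl b.2)
          * (axEc ρF LFc (b'.1 : Site (3 + 1)) (b'.1 : Site (3 + 1)) (Sum.inl b'.2) (Sum.inl b'.2) * perF (towerTorus Lc (M' B) (n + 1)) AF (b.1, Sum.inl b.2) (b'.1, Sum.inl b'.2)))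
      (Matrix.of fun (b : (↥(pbox (towerTorus Lc (M' B) (n + 1))) × Fin (3 + 1))) (a : (↥(pbox (M' B)) × Fin (3 + 1))) =>
        axEc ρF LFc (b.1 : Site (3 + 1)) (b.1 : Site (3 + 1)) (Sum.inl b.2) (Sum.inl b.2) * perF (towerTorus Lc (M' B) (n + 1)) AF (b.1, Sum.inl b.2) ((fF B) a))
      (-Matrix.of fun (a : (↥(pbox (M' B)) × Fin (3 + 1))) (b : (↥(pbox (towerTorus Lc (M' B) (n + 1))) × Fin (3 + 1))) =>
        axEc ρF LFc (b.1 : Site (3 + 1)) (b.1 : Site (3 + 1)) (Sum.inl b.2) (Sum.inl b.2) * perF (towerTorus Lc (M' B) (n + 1)) AF ((fF B) a) (b.1, Sum.inl b.2))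
      (-((perF (towerTorus Lc (M' B) (n + 1)) AF).submatrix (fF B) (fF B))))
    -- (S3-2) F — the lattice base-point jets of the tower below: bi-localised, and PER BOX their periodisations ARE the door's fine jets in the directions `a₁ a₂`
    {pF pF' qF qF' : Fin (3 + 1) → ℤ} {CvF CvF' CwF δF : ℝ} (hVF : BiLoc (𝒱F μ 0) pF pF' CvF δF) (hVF' : BiLoc (𝒱F ν z) qF' qF CvF' δF)
    (hWF : BiLoc (𝒲F μ 0 ν z) pF qF CwF δF) (hδF : 0 < δF)
    (hVFm : ∀ B : ℕ, ∀ a a' : (↥(pbox (M' B)) × Fin (3 + 1)), (perF (towerTorus Lc (M' B) (n + 1)) (dper (towerTorus Lc (M' B) (n + 1)) (𝒱F μ 0))) ((fF B) a) ((fF B) a') = 0)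
    (hVFt : ∀ B : ℕ, ∀ (b : (↥(pbox (towerTorus Lc (M' B) (n + 1))) × Fin (3 + 1))) (a : (↥(pbox (M' B)) × Fin (3 + 1))), (perF (towerTorus Lc (M' B) (n + 1)) (dper (towerTorus Lc (M' B) (n + 1)) (𝒱F μ 0))) (b.1, Sum.inl b.2) ((fF B) a) = (perF (towerTorus Lc (M' B) (n + 1)) (dper (towerTorus Lc (M' B) (n + 1)) (𝒱F μ 0))) ((fF B) a) (b.1, Sum.inl b.2))
    (hVF'm : ∀ B : ℕ, ∀ a a' : (↥(pbox (M' B)) × Fin (3 + 1)), (perF (towerTorus Lc (M' B) (n + 1)) (dper (towerTorus Lc (M' B) (n + 1)) (𝒱F ν z))) ((fF B) a) ((fF B) a') = 0)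
    (hVF't : ∀ B : ℕ, ∀ (b : (↥(pbox (towerTorus Lc (M' B) (n + 1))) × Fin (3 + 1))) (a : (↥(pbox (M' B)) × Fin (3 + 1))), (perF (towerTorus Lc (M' B) (n + 1)) (dper (towerTorus Lc (M' B) (n + 1)) (𝒱F ν z))) (b.1, Sum.inl b.2) ((fF B) a) = (perF (towerTorus Lc (M' B) (n + 1)) (dper (towerTorus Lc (M' B) (n + 1)) (𝒱F ν z))) ((fF B) a) (b.1, Sum.inl b.2))
    (hWFm : ∀ B : ℕ, ∀ a a' : (↥(pbox (M' B)) × Fin (3 + 1)), (perF (towerTorus Lc (M' B) (n + 1)) (dper (towerTorus Lc (M' B) (n + 1)) (𝒲F μ 0 ν z))) ((fF B) a) ((fF B) a') = 0)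
    (hWFt : ∀ B : ℕ, ∀ (b : (↥(pbox (towerTorus Lc (M' B) (n + 1))) × Fin (3 + 1))) (a : (↥(pbox (M' B)) × Fin (3 + 1))), (perF (towerTorus Lc (M' B) (n + 1)) (dper (towerTorus Lc (M' B) (n + 1)) (𝒲F μ 0 ν z))) (b.1, Sum.inl b.2) ((fF B) a) = -(perF (towerTorus Lc (M' B) (n + 1)) (dper (towerTorus Lc (M' B) (n + 1)) (𝒲F μ 0 ν z))) ((fF B) a) (b.1, Sum.inl b.2))
    (hHF₁ : ∀ B : ℕ, H₁f B (dv B a₁) = (perF (towerTorus Lc (M' B) (n + 1)) (dper (towerTorus Lc (M' B) (n + 1)) (𝒱F μ 0))).submatrix (fun b : (↥(pbox (towerTorus Lc (M' B) (n + 1))) × Fin (3 + 1)) => ((b.1, Sum.inl b.2) : Idx (towerTorus Lc (M' B) (n + 1)) (Fib 3))) (fun b : (↥(pbox (towerTorus Lc (M' B) (n + 1))) × Fin (3 + 1)) => ((b.1, Sum.inl b.2) : Idx (towerTorus Lc (M' B) (n + 1)) (Fib 3))))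
    (hQF₁ : ∀ B : ℕ, Q₁₁f B (dv B a₁) = (perF (towerTorus Lc (M' B) (n + 1)) (dper (towerTorus Lc (M' B) (n + 1)) (𝒱F μ 0))).submatrix (fF B) (fun b : (↥(pbox (towerTorus Lc (M' B) (n + 1))) × Fin (3 + 1)) => ((b.1, Sum.inl b.2) : Idx (towerTorus Lc (M' B) (n + 1)) (Fib 3))))
    (hHF₁' : ∀ B : ℕ, H₁f B (dv B a₂) = (perF (towerTorus Lc (M' B) (n + 1)) (dper (towerTorus Lc (M' B) (n + 1)) (𝒱F ν z))).submatrix (fun b : (↥(pbox (towerTorus Lc (M' B) (n + 1))) × Fin (3 + 1)) => ((b.1, Sum.inl b.2) : Idx (towerTorus Lc (M' B) (n + 1)) (Fib 3))) (fun b : (↥(pbox (towerTorus Lc (M' B) (n + 1))) × Fin (3 + 1)) => ((b.1, Sum.inl b.2) : Idx (towerTorus Lc (M' B) (n + 1)) (Fib 3))))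
    (hQF₁' : ∀ B : ℕ, Q₁₁f B (dv B a₂) = (perF (towerTorus Lc (M' B) (n + 1)) (dper (towerTorus Lc (M' B) (n + 1)) (𝒱F ν z))).submatrix (fF B) (fun b : (↥(pbox (towerTorus Lc (M' B) (n + 1))) × Fin (3 + 1)) => ((b.1, Sum.inl b.2) : Idx (towerTorus Lc (M' B) (n + 1)) (Fib 3))))
    (hHF₂ : ∀ B : ℕ, (1 / 2 : ℝ) • (H₂f B (dv B a₁) (dv B a₂) + H₂f B (dv B a₂) (dv B a₁)) = (perF (towerTorus Lc (M' B) (n + 1)) (dper (towerTorus Lc (M' B) (n + 1)) (𝒲F μ 0 ν z))).submatrix (fun b : (↥(pbox (towerTorus Lc (M' B) (n + 1))) × Fin (3 + 1)) => ((b.1, Sum.inl b.2) : Idx (towerTorus Lc (M' B) (n + 1)) (Fib 3))) (fun b : (↥(pbox (towerTorus Lc (M' B) (n + 1))) × Fin (3 + 1)) => ((b.1, Sum.inl b.2) : Idx (towerTorus Lc (M' B) (n + 1)) (Fib 3))))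
    (hQF₂ : ∀ B : ℕ, (1 / 2 : ℝ) • (Q₁₂f B (dv B a₁) (dv B a₂) + Q₁₂f B (dv B a₂) (dv B a₁)) = (perF (towerTorus Lc (M' B) (n + 1)) (dper (towerTorus Lc (M' B) (n + 1)) (𝒲F μ 0 ν z))).submatrix (fF B) (fun b : (↥(pbox (towerTorus Lc (M' B) (n + 1))) × Fin (3 + 1)) => ((b.1, Sum.inl b.2) : Idx (towerTorus Lc (M' B) (n + 1)) (Fib 3))))
    -- (S3-2) G — the lattice base-point jets of the TOP STEP: bi-localised, and PER BOX their periodisations on `M′ B` ARE the door's `G` jets at the slots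
    -- `a ↦ (pμ′ B a, inr (mμ′ B a))`, the H-blocks CARRYING THE UNIT `∏_{i<n+1} wVH 3 Lc (lev i)` (DISPLAYED — an2's (C1) naming item, SPEC-45 §C ∕ J-RISK-4 ∕ J-NOTE-6)
    {pG pG' qG qG' : Fin (3 + 1) → ℤ} {CvG CvG' CwG δG : ℝ} (hVG : BiLoc (𝒱G μ 0) pG pG' CvG δG) (hVG' : BiLoc (𝒱G ν z) qG' qG CvG' δG)
    (hWG : BiLoc (𝒲G μ 0 ν z) pG qG CwG δG) (hδG : 0 < δG)
    (hVGm : ∀ B : ℕ, ∀ a a' : κ B, (perF (M' B) (dper (M' B) (𝒱G μ 0))) ((((pμ' B) a, Sum.inr ((mμ' B) a)) : Idx (M' B) (Fib 3))) ((((pμ' B) a', Sum.inr ((mμ' B) a')) : Idx (M' B) (Fib 3))) = 0)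
    (hVGt : ∀ B : ℕ, ∀ (b : (↥(pbox (M' B)) × Fin (3 + 1))) (a : κ B), (perF (M' B) (dper (M' B) (𝒱G μ 0))) (b.1, Sum.inl b.2) ((((pμ' B) a, Sum.inr ((mμ' B) a)) : Idx (M' B) (Fib 3))) = (perF (M' B) (dper (M' B) (𝒱G μ 0))) ((((pμ' B) a, Sum.inr ((mμ' B) a)) : Idx (M' B) (Fib 3))) (b.1, Sum.inl b.2))
    (hVG'm : ∀ B : ℕ, ∀ a a' : κ B, (perF (M' B) (dper (M' B) (𝒱G ν z))) ((((pμ' B) a, Sum.inr ((mμ' B) a)) : Idx (M' B) (Fib 3))) ((((pμ' B) a', Sum.inr ((mμ' B) a')) : Idx (M' B) (Fib 3))) = 0)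
    (hVG't : ∀ B : ℕ, ∀ (b : (↥(pbox (M' B)) × Fin (3 + 1))) (a : κ B), (perF (M' B) (dper (M' B) (𝒱G ν z))) (b.1, Sum.inl b.2) ((((pμ' B) a, Sum.inr ((mμ' B) a)) : Idx (M' B) (Fib 3))) = (perF (M' B) (dper (M' B) (𝒱G ν z))) ((((pμ' B) a, Sum.inr ((mμ' B) a)) : Idx (M' B) (Fib 3))) (b.1, Sum.inl b.2))
    (hWGm : ∀ B : ℕ, ∀ a a' : κ B, (perF (M' B) (dper (M' B) (𝒲G μ 0 ν z))) ((((pμ' B) a, Sum.inr ((mμ' B) a)) : Idx (M' B) (Fib 3))) ((((pμ' B) a', Sum.inr ((mμ' B) a')) : Idx (M' B) (Fib 3))) = 0)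
    (hWGt : ∀ B : ℕ, ∀ (b : (↥(pbox (M' B)) × Fin (3 + 1))) (a : κ B), (perF (M' B) (dper (M' B) (𝒲G μ 0 ν z))) (b.1, Sum.inl b.2) ((((pμ' B) a, Sum.inr ((mμ' B) a)) : Idx (M' B) (Fib 3))) = -(perF (M' B) (dper (M' B) (𝒲G μ 0 ν z))) ((((pμ' B) a, Sum.inr ((mμ' B) a)) : Idx (M' B) (Fib 3))) (b.1, Sum.inl b.2))
    (hHG₁ : ∀ B : ℕ, (∏ i ∈ range (n + 1), wVH 3 Lc (lev i)) • Gw₁f B (dv B a₁) = (perF (M' B) (dper (M' B) (𝒱G μ 0))).submatrix (fun b : (↥(pbox (M' B)) × Fin (3 + 1)) => ((b.1, Sum.inl b.2) : Idx (M' B) (Fib 3))) (fun b : (↥(pbox (M' B)) × Fin (3 + 1)) => ((b.1, Sum.inl b.2) : Idx (M' B) (Fib 3))))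
    (hQG₁ : ∀ B : ℕ, Q₂₁f B (dv B a₁) = (perF (M' B) (dper (M' B) (𝒱G μ 0))).submatrix (fun a : κ B => ((((pμ' B) a, Sum.inr ((mμ' B) a)) : Idx (M' B) (Fib 3)))) (fun b : (↥(pbox (M' B)) × Fin (3 + 1)) => ((b.1, Sum.inl b.2) : Idx (M' B) (Fib 3))))
    (hHG₁' : ∀ B : ℕ, (∏ i ∈ range (n + 1), wVH 3 Lc (lev i)) • Gw₁f B (dv B a₂) = (perF (M' B) (dper (M' B) (𝒱G ν z))).submatrix (fun b : (↥(pbox (M' B)) × Fin (3 + 1)) => ((b.1, Sum.inl b.2) : Idx (M' B) (Fib 3))) (fun b : (↥(pbox (M' B)) × Fin (3 + 1)) => ((b.1, Sum.inl b.2) : Idx (M' B) (Fib 3))))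
    (hQG₁' : ∀ B : ℕ, Q₂₁f B (dv B a₂) = (perF (M' B) (dper (M' B) (𝒱G ν z))).submatrix (fun a : κ B => ((((pμ' B) a, Sum.inr ((mμ' B) a)) : Idx (M' B) (Fib 3)))) (fun b : (↥(pbox (M' B)) × Fin (3 + 1)) => ((b.1, Sum.inl b.2) : Idx (M' B) (Fib 3))))
    (hHG₂ : ∀ B : ℕ, (∏ i ∈ range (n + 1), wVH 3 Lc (lev i)) • ((1 / 2 : ℝ) • (Gw₂f B (dv B a₁) (dv B a₂) + Gw₂f B (dv B a₂) (dv B a₁))) = (perF (M' B) (dper (M' B) (𝒲G μ 0 ν z))).submatrix (fun b : (↥(pbox (M' B)) × Fin (3 + 1)) => ((b.1, Sum.inl b.2) : Idx (M' B) (Fib 3))) (fun b : (↥(pbox (M' B)) × Fin (3 + 1)) => ((b.1, Sum.inl b.2) : Idx (M' B) (Fib 3))))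
    (hQG₂ : ∀ B : ℕ, (1 / 2 : ℝ) • (Q₂₂f B (dv B a₁) (dv B a₂) + Q₂₂f B (dv B a₂) (dv B a₁)) = (perF (M' B) (dper (M' B) (𝒲G μ 0 ν z))).submatrix (fun a : κ B => ((((pμ' B) a, Sum.inr ((mμ' B) a)) : Idx (M' B) (Fib 3)))) (fun b : (↥(pbox (M' B)) × Fin (3 + 1)) => ((b.1, Sum.inl b.2) : Idx (M' B) (Fib 3))))
    : hessKer AN 𝒱N 𝒲N μ ν z
      = hessKer AF 𝒱F 𝒲F μ ν z + hessKer (GcombSh (d := 3) Lc (lev 0)) 𝒱G 𝒲G μ ν z := by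
  have hc : ctrOff (3 + 1) Lc ∈ box (3 + 1) Lc := ctrOff_mem_box (d := 3 + 1) (Nat.one_le_iff_ne_zero.mpr (NeZero.ne Lc))
  have hvl : ∀ B : ℕ, ∀ (r : ℝ) (x y : κ B → ℝ), (hv B) (r • x + y) = r • (hv B) x + (hv B) y := fun B r x y => by
    rw [hhv B, hhv B, hhv B]; exact nestedColumn_linear _ _ r x y
  obtain ⟨CAG, αG, hαG, hAG⟩ := (lattice_letters_combSym (d := 3) Lc (lev 0)).1
  exact hessKer_law_tower_sym (Lc := Lc) (M' := M') (lev := lev) (n := n) (V := fun B => κ B → ℝ) (AG := (GcombSh (d := 3) Lc (lev 0))) (hM'gr := hM'gr) (hrs := (fun _ => hc))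
    (hlev := hlev) (𝒱N := 𝒱N) (𝒱F := 𝒱F) (𝒱G := 𝒱G) (𝒲N := 𝒲N) (𝒲F := 𝒲F) (𝒲G := 𝒲G) (μ := μ) (ν := ν) (z := z) (hM' := hM') (pμ' := pμ') (mμ' := mμ')
    (hfμ' := hfμ') (hcoarse' := hcoarse') (hH₀ := hH₀) (hQ₁₀ := hQ₁₀) (hτ₁ := (fun B => hτ₁ B))
    (hSL := (fun B => det_nestedSliceSym_mul_towerGen_ne_zero Lc (compRowsSym_mul_towerGen_succ Lc hc) n (fine Lc (M' B)) (fun k => lev (k + 1)) (dvd_fine (M' B))))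
    (hτ₂ := hτ₂) (hQ₂₀ := hQ₂₀) (hW₀ := hW₀) (hP := hP) (c := c) (hDbar := hDbar)
    (c0 := (fun B => by rw [hQ₁₀ B, hW₀ B, hDbar B]; exact compRowsSym_mul_towerGen_succ Lc hc n (M' B) lev))
    (hTW := (fun B => torus_hTW_oneShot_towerSym (M' B) Lc lev (fun _ : ℕ => ctrOff (3 + 1) Lc) n (fun _ => hc) (hM' B) (compRowsSym_mul_towerGen_succ Lc hc n (M' B) lev) (hQ₁₀ B) (hτ₁ B) (hτ₂ B) (hW₀ B)))
    (hΓ := hΓ) (hI := hI) (hL := hL) (hS := hS) (h𝔔₀ := h𝔔₀) (hv := hv) (lv := lv) (hlv := hlv) (Xbf := Xbf) (hXbf := hXbf) (H₁f := H₁f) (hH₁l := hH₁l)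
    (Q₁₁f := Q₁₁f)
    (hQ₁₁l := (fun B r x y => by rw [hQ₁₁f B, hQ₁₁f B, hQ₁₁f B]; exact Q11f_lin Lc (M' B) lev (fun _ : ℕ => ctrOff (3 + 1) Lc) n c (hv B) (hvl B) r x y))
    (Q₂₁f := Q₂₁f)
    (hQ₂₁l := (fun B r x y => by rw [hQ₂₁f B, hQ₂₁f B, hQ₂₁f B]; exact Q21f_lin Lc (M' B) lev (fun _ : ℕ => ctrOff (3 + 1) Lc) n c (hv B) (pμ' B) (mμ' B) (hvl B) r x y))
    (H₂f := H₂f) (hH₂l := hH₂l) (hH₂r := hH₂r) (Q₁₂f := Q₁₂f)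
    (hQ₁₂l := (fun B r x y w => by rw [hQ₁₂f B, hQ₁₂f B, hQ₁₂f B]; exact Q12f_lin_left Lc (M' B) lev (fun _ : ℕ => ctrOff (3 + 1) Lc) n c (hv B) (hvl B) r x y w))
    (hQ₁₂r := (fun B r x y w => by rw [hQ₁₂f B, hQ₁₂f B, hQ₁₂f B]; exact Q12f_lin_right Lc (M' B) lev (fun _ : ℕ => ctrOff (3 + 1) Lc) n c (hv B) hc (hvl B) r x y w))
    (Q₂₂f := Q₂₂f)
    (hQ₂₂l := (fun B r x y w => by rw [hQ₂₂f B, hQ₂₂f B, hQ₂₂f B]; exact Q22f_lin_left Lc (M' B) lev (fun _ : ℕ => ctrOff (3 + 1) Lc) n c (hv B) (pμ' B) (mμ' B) (hvl B) r x y w))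
    (hQ₂₂r := (fun B r x y w => by rw [hQ₂₂f B, hQ₂₂f B, hQ₂₂f B]; exact Q22f_lin_right Lc (M' B) lev (fun _ : ℕ => ctrOff (3 + 1) Lc) n c (hv B) (pμ' B) (mμ' B) (hvl B) r x y w))
    (𝔔₁f := 𝔔₁f) (h𝔔₁ := h𝔔₁) (𝔔₂f := 𝔔₂f) (h𝔔₂ := h𝔔₂) (H'₁f := H'₁f) (hH'₁f := hH'₁f) (H'₂f := H'₂f) (hH'₂f := hH'₂f) (𝔔'₁f := 𝔔'₁f) (h𝔔'₁f := h𝔔'₁f)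
    (𝔔'₂f := 𝔔'₂f) (h𝔔'₂f := h𝔔'₂f) (W₁f := W₁f) (W₂f := W₂f) (hW₁f := hW₁f) (hW₂f := hW₂f) (Db₁f := Db₁f) (Db₂f := Db₂f) (Y₁f := Y₁f) (Y₂f := Y₂f)
    (Gw₁f := Gw₁f) (hGw₁f := hGw₁f) (Gw₂f := Gw₂f) (hGw₂f := hGw₂f)
    (uTop := (fun B v => torus_uTop_towerSym_closed (M' B) Lc lev n hlev (hM' B) (pμ' B) (mμ' B) (hfμ' B) (hcoarse' B) (hH₀ B) (hQ₁₀ B) (hτ₁ B) (hτ₂ B) (hQ₂₀ B) (hDbar B) (hI B) (hS B) c v (hhv B v) (hDb₁f B v) (hDb₂f B v)))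
    (hH₁t := hH₁t) (hH₂t := hH₂t) (d0 := (fun B => by rw [hQ₂₀ B, hDbar B]; exact QtopSym_mul_smul_tgrad_res Lc (M' B) (hM' B) (lev 0) _ (pμ' B) (mμ' B)))
    (a1 := a1) (a2 := a2) (c1 := (fun B v => by rw [hQ₁₁f B, hDb₁f B, hQ₁₀ B, hW₀ B]; exact torus_c1_towerSym Lc (M' B) lev hc n c ((hv B) v) (hW₁f B v)))
    (c2 := (fun B v => by rw [hQ₁₂f B, hQ₁₁f B, hDb₂f B, hQ₁₀ B, hW₀ B]; exact torus_c2_towerSym_polar Lc (M' B) lev n c hc ((hv B) v) (hW₁f B v) (hW₂f B v)))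
    (d1 := (fun B v => by rw [hQ₂₁f B, hDb₁f B, hQ₂₀ B, hDbar B]; exact torus_d1_towerSym Lc (M' B) lev hc (hM' B) n c ((hv B) v) (pμ' B) (mμ' B)))
    (d2 := (fun B v => by rw [hQ₂₂f B, hQ₂₁f B, hDb₁f B, hDb₂f B, hQ₂₀ B, hDbar B]; exact torus_d2_towerSym Lc (M' B) lev hc (hM' B) n c ((hv B) v) (pμ' B) (mμ' B)))
    (dv := dv) (a₁ := a₁) (a₂ := a₂) (hXN := hXN) (ρN := ρN) (LNc := LNc) (fN := fN) (hfN := hfN) (hmN := hmN) (hcN := hcN) (hAN := hAN) (hαN := hαN)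
    (hANsh := hANsh) (hEAN := hEAN) (hAEN := hAEN) (hLN := hLN) (hVN := hVN) (hVN' := hVN') (hWN := hWN) (hδN := hδN) (hVNm := hVNm) (hVNt := hVNt)
    (hVN'm := hVN'm) (hVN't := hVN't) (hWNm := hWNm) (hWNt := hWNt) (hHN₁ := hHN₁) (hQN₁ := hQN₁) (hHN₁' := hHN₁') (hQN₁' := hQN₁') (hHN₂ := hHN₂)
    (hQN₂ := hQN₂) (hXF := hXF) (ρF := ρF) (LFc := LFc) (fF := fF) (hfF := hfF) (hmF := hmF) (hcF := hcF) (hAF := hAF) (hαF := hαF) (hAFsh := hAFsh)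
    (hEAF := hEAF) (hAEF := hAEF) (hLF := hLF) (hVF := hVF) (hVF' := hVF') (hWF := hWF) (hδF := hδF) (hVFm := hVFm) (hVFt := hVFt) (hVF'm := hVF'm)
    (hVF't := hVF't) (hWFm := hWFm) (hWFt := hWFt) (hHF₁ := hHF₁) (hQF₁ := hQF₁) (hHF₁' := hHF₁') (hQF₁' := hQF₁') (hHF₂ := hHF₂) (hQF₂ := hQF₂)
    (hXG := (fun B => kkt_mul_inv_combSym (M' B) (hM' B) (lev 0) (pμ' B) (mμ' B) (hfμ' B) (hcoarse' B) (hQ₂₀ B) (hτ₂ B))) (ρG := (ctr (3 + 1) Lc))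
    (LGc := Lc) (fG := (fun B a => ((((pμ' B) a, Sum.inr ((mμ' B) a)) : Idx (M' B) (Fib 3))))) (hfG := hfμ') (hmG := (fun B a => ⟨(mμ' B) a, rfl⟩))
    (hcG := hcoarse') (hAG := hAG) (hαG := hαG) (hAGsh := (lattice_letters_combSym (d := 3) Lc (lev 0)).2)
    (hEAG := (fun B => (perF_rules_combSym (M' B) (hM' B) (lev 0)).1)) (hAEG := (fun B => (perF_rules_combSym (M' B) (hM' B) (lev 0)).2))
    (hLG := (fun B => packedLeg_combSym_eq (M' B) (hM' B) (lev 0) (pμ' B) (mμ' B) (hfμ' B) (hcoarse' B) (hQ₂₀ B) (hτ₂ B))) (hVG := hVG) (hVG' := hVG')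
    (hWG := hWG) (hδG := hδG) (hVGm := hVGm) (hVGt := hVGt) (hVG'm := hVG'm) (hVG't := hVG't) (hWGm := hWGm) (hWGt := hWGt) (hHG₁ := hHG₁) (hQG₁ := hQG₁)
    (hHG₁' := hHG₁') (hQG₁' := hQG₁') (hHG₂ := hHG₂) (hQG₂ := hQG₂)

end Named

end Summit.QuantumFields.BalabanUV.Beta.FP.TowerKernelLawNamed

end
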